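import Literature.AnabelianGeometry.AbsoluteAnabelian.AbsTopII.InertiaGroups
import Literature.AnabelianGeometry.AbsoluteAnabelian.AbsTopII.InertiaDecompositionProofs

/-!
# [AbsTopII] Prop 1.3 (ii) as typed: the DIAGONAL vertex pair — kernel certificates

S. Mochizuki, *Topics in Absolute Anabelian Geometry II* [AbsTopII] (bib `MochizukiAbsTopII2013`;
locators = PDF pages of the kurims manuscript `paper:url-585b8d0ad0d9`), §1, Def 1.2 (ii) p. 10 and
Prop 1.3 (ii) p. 11:

> "(ii) If `e` is a node of `𝔾`, then we have a natural exact sequence `1 → Π_e → I_e → I → 1`; as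
> abstract profinite groups, `I_e ≅ Ẑ^Σ × Ẑ^Σ`. If `e` abuts to vertices `v, v′`, then [for
> appropriate choices of conjugates of the various inertia groups involved] we have inclusions
> `I_v, I_{v′} ⊆ I_e`, and the natural morphism `I_v × I_{v′} → I_e` is an open injective
> homomorphism, with image of index equal to `i^Σ_e`."

In print, "`e` abuts to vertices `v, v′`" names the TWO BRANCHES of the node `e` (for a loop the two
branches sit at the same vertex `v = v′`; for a non-loop node `v ≠ v′`).  abc-iut-L4-t6's typing
`DPSCIndexData.Prop_1_3_ii` (`AbsTopII/InertiaGroups.lean`, p405221 / v2 p427327; FACT-LIST row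
F-0298) renders the last sentence as

  `∀ v v' : X.Vert, X.nodeAbuts e v → X.nodeAbuts e v' → ∃ g g' : X.PiH, ∃ J, IsInternalProduct
   (MulAut.conj g • X.Iv v) (MulAut.conj g' • X.Iv v') J ∧ J ≤ X.IvNode e ∧ …`,

two INDEPENDENT universally quantified vertices over the bare incidence relation `nodeAbuts`.  For a
NON-LOOP node `e` with end-vertices `v ≠ v′` this also demands the DIAGONAL instance `(v, v)`: two
`Π_H`-conjugates of the SAME inertia group `I_v`, both inside `I_e`, meeting trivially
(`IsInternalProduct.inf_eq_bot`) — `prop_1_3_ii_diagonal` below makes this consequence explicit.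

At the data of Def 1.2 (ii) (a stable log curve over a log point; `H ⊇ I`) this diagonal instance is
FALSE whenever the outer action of `H` on `𝔾` does not exchange the two end-vertices of `e` (e.g.
`H = I`, `ι = id`): then every `Π_H`-conjugate `g·I_v·g⁻¹ = I_{g·ṽ}` lying in `I_e = I_ẽ` is the
inertia group of a pro-vertex over `v` fixing the pro-node `ẽ`; since `I_ẽ ≅ Ẑ^Σ × Ẑ^Σ` is abelian,
`g·I_v·g⁻¹ ≤ Z_{Π_I}(I_v) = D_v ∩ Π_I = I_v × Π_v` (Prop 1.3 (v), (iii)), its `Π_v`-component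
centralises `Π_e`, hence lies in `Π_e` ([CombGC] Prop 1.2 (ii) / Prop 1.3 (vii)), and the symmetric
inclusion `I_v ≤ I_{g·ṽ} × Π_{g·ṽ}` together with `Π_e ∩ Π_{g·ṽ} = {1}` for `g·ṽ ∉ {ṽ, ṽ′}` forces
`g·I_v·g⁻¹ = I_v` — so ALL `Π_H`-conjugates of `I_v` inside `I_e` COINCIDE (hypothesis `hconj`
below), and two of them cannot meet trivially (`I_v ≅ Ẑ^Σ ≠ 1`, Prop 1.3 (iii)).  For a LOOP the
diagonal instance is exactly print's statement (the two branch conjugates `I_ṽ`, `I_{γ·ṽ}`,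
`γ ∈ Π_𝔾`) and is unaffected.

This proof-only file (no definitions) records, as KERNEL CERTIFICATES over the abstract data:
* `prop_1_3_ii_diagonal` — the typed predicate entails the diagonal instance at every end-vertex;
* `not_prop_1_3_ii_of_conj_meet` / `not_prop_1_3_ii_of_conj_eq` — the typed predicate FAILS on any
  data with a node `e` and an end-vertex `v`, `I_v ≠ 1`, all of whose `Π_H`-conjugates inside `I_e`
  meet non-trivially (resp. coincide) — the model situation above;
* `not_prop_1_3_ii_of_conj_eq_of_prop_1_3_iii'` — idem with `I_v ≠ 1` supplied by the typed
  Prop 1.3 (iii) (`I_v ≅ Ẑ^Σ`, `infinite_Iv_of_prop_1_3_iii'`): the typed (ii) and (iii) are jointly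
  unsatisfiable at such data.
REPAIR proposed to the typer of record (abc-iut-L4-t6 lineage; sibling of finding F-L4t6g5-1 /
`AbsTopII/InertiaGroupsScope.lean`): guard the last clause of (ii) by
`v ≠ v' ∨ (∀ w, X.nodeAbuts e w → w = v)` (distinct end-vertices, or a loop), or re-type the
end-vertices of a node as an unordered pair with multiplicity.  The first two clauses of (ii) and the
group-theoretic consumers (`prop13vii_of_prop_1_3_ii`, `prop13ix_of_prop_1_3_i_ii`: they use only
`Π_e ⊆ I_e`, `I_e·Π_𝔾 = Π_I`) are unaffected.
HONEST FRAMING: a statement-faithfulness finding about the cell's own typing, with its repair; it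
says nothing about the truth of the printed Prop 1.3 and nothing about [IUTchIII] Cor 3.12.
Audit provenance: RQ7 second read of p427327 by abc-iut-w5-d102 (gen 5), 2026-08-26.
-/

open scoped Pointwise

namespace Literature.AnabelianGeometry.AbsoluteAnabelian.AbsTopII.DPSCIndexData

universe u

variable (X : DPSCIndexData.{u})

/-- **The diagonal instance.** `DPSCIndexData.Prop_1_3_ii` AS TYPED yields, for EVERY node `e` and
EVERY single vertex `v` with `nodeAbuts e v` (in particular for an end-vertex of a NON-LOOP node),
two `Π_H`-conjugates of the same `I_v`, both inside `I_e`, forming an internal direct product — in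
particular meeting trivially.  Print asks this only for the two branches `v, v′` of `e`.
[cite: MochizukiAbsTopII2013, Prop 1.3 (ii) p.11] -/
theorem prop_1_3_ii_diagonal
    (h : Literature.AnabelianGeometry.AbsoluteAnabelian.AbsTopII.DPSCIndexData.Prop_1_3_ii X)
    {e : X.Node} {v : X.Vert} (hv : X.nodeAbuts e v) :
    ∃ g g' : X.PiH, ∃ J : Subgroup X.PiH,
      IsInternalProduct (MulAut.conj g • X.Iv v) (MulAut.conj g' • X.Iv v) J ∧
        J ≤ X.IvNode e ∧
        IsOpen ((J.subgroupOf (X.IvNode e) : Subgroup ↥(X.IvNode e)) : Set ↥(X.IvNode e)) ∧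
        J.relIndex (X.IvNode e) = X.sigmaIndex e :=
  (h e).2.2 v v hv hv

/-- **Certificate (ii), meeting conjugates.** `DPSCIndexData.Prop_1_3_ii` AS TYPED FAILS on any DPSC
data with a node `e` and a vertex `v`, `nodeAbuts e v`, such that any two `Π_H`-conjugates of `I_v`
contained in `I_e` meet non-trivially — the situation of a non-loop node of a stable log curve whose
end-vertices are not exchanged by the outer action of `H` (all such conjugates then equal the
inertia group of the unique pro-vertex over `v` on the chosen pro-node, and `I_v ≅ Ẑ^Σ ≠ 1`).
[cite: MochizukiAbsTopII2013, Prop 1.3 (ii) p.11] -/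
theorem not_prop_1_3_ii_of_conj_meet {e : X.Node} {v : X.Vert} (hv : X.nodeAbuts e v)
    (hmeet : ∀ g g' : X.PiH, MulAut.conj g • X.Iv v ≤ X.IvNode e →
      MulAut.conj g' • X.Iv v ≤ X.IvNode e →
        MulAut.conj g • X.Iv v ⊓ MulAut.conj g' • X.Iv v ≠ ⊥) :
    ¬ Literature.AnabelianGeometry.AbsoluteAnabelian.AbsTopII.DPSCIndexData.Prop_1_3_ii X := by
  intro h
  obtain ⟨g, g', J, hJ, hJle, -, -⟩ := X.prop_1_3_ii_diagonal h hv
  exact hmeet g g' (hJ.left_le.trans hJle) (hJ.right_le.trans hJle) hJ.inf_eq_bot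

/-- A pointwise conjugate of a non-trivial subgroup is non-trivial. [folklore] -/
private theorem conj_smul_ne_bot {G : Type u} [Group G] (g : G) {K : Subgroup G} (hK : K ≠ ⊥) :
    MulAut.conj g • K ≠ ⊥ := by
  intro h
  apply hK
  have : (MulAut.conj g)⁻¹ • (MulAut.conj g • K) = ⊥ := by rw [h, Subgroup.smul_bot]
  rwa [inv_smul_smul] at this

/-- **Certificate (ii), coinciding conjugates.** `DPSCIndexData.Prop_1_3_ii` AS TYPED FAILS on any
DPSC data with a node `e` and a vertex `v`, `nodeAbuts e v`, `I_v ≠ 1`, all of whose `Π_H`-conjugates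
of `I_v` contained in `I_e` COINCIDE (the model situation described in the module docstring: a
non-loop node whose end-vertices are fixed by the outer `H`-action, e.g. `H = I`).
[cite: MochizukiAbsTopII2013, Prop 1.3 (ii) p.11] -/
theorem not_prop_1_3_ii_of_conj_eq {e : X.Node} {v : X.Vert} (hv : X.nodeAbuts e v)
    (hI : X.Iv v ≠ ⊥)
    (hconj : ∀ g g' : X.PiH, MulAut.conj g • X.Iv v ≤ X.IvNode e →
      MulAut.conj g' • X.Iv v ≤ X.IvNode e → MulAut.conj g • X.Iv v = MulAut.conj g' • X.Iv v) :
    ¬ Literature.AnabelianGeometry.AbsoluteAnabelian.AbsTopII.DPSCIndexData.Prop_1_3_ii X :=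
  X.not_prop_1_3_ii_of_conj_meet hv fun g g' hg hg' => by
    rw [hconj g g' hg hg', inf_idem]
    exact conj_smul_ne_bot g' hI

/-- **Certificate (ii) + (iii).** With `I_v ≠ 1` supplied by the typed Prop 1.3 (iii)
(`DPSCIndexData.Prop_1_3_iii'`: `I_v ≅ Ẑ^Σ`, infinite as `Σ` contains a prime —
`infinite_Iv_of_prop_1_3_iii'`), the typed Prop 1.3 (ii) and (iii) are JOINTLY UNSATISFIABLE at any
DPSC data with a node `e`, `nodeAbuts e v`, all of whose `Π_H`-conjugates of `I_v` inside `I_e`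
coincide. [cite: MochizukiAbsTopII2013, Prop 1.3 (ii)(iii) p.11] -/
theorem not_prop_1_3_ii_of_conj_eq_of_prop_1_3_iii'
    (hiii : Literature.AnabelianGeometry.AbsoluteAnabelian.AbsTopII.DPSCIndexData.Prop_1_3_iii' X)
    {e : X.Node} {v : X.Vert} (hv : X.nodeAbuts e v)
    (hconj : ∀ g g' : X.PiH, MulAut.conj g • X.Iv v ≤ X.IvNode e →
      MulAut.conj g' • X.Iv v ≤ X.IvNode e → MulAut.conj g • X.Iv v = MulAut.conj g' • X.Iv v) :
    ¬ Literature.AnabelianGeometry.AbsoluteAnabelian.AbsTopII.DPSCIndexData.Prop_1_3_ii X := by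
  haveI : Infinite ↥(X.Iv v) := X.infinite_Iv_of_prop_1_3_iii' hiii v
  refine X.not_prop_1_3_ii_of_conj_eq hv ?_ hconj
  intro hbot
  have : Finite ↥(X.Iv v) := by
    rw [hbot]
    infer_instance
  exact not_finite ↥(X.Iv v)

end Literature.AnabelianGeometry.AbsoluteAnabelian.AbsTopII.DPSCIndexData
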